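import Summits.CriticalPhenomena.PercolationContinuityZ3.Theorems.FK.BoundaryConditionInfluence
import Summits.CriticalPhenomena.PercolationContinuityZ3.Theorems.FK.OSSSWiredBoxRevealment
import HarnessLib

/-!
# FK-continuity cell, FO-10a: boundary-condition influence for the region laws of `ℤ^d` — `φ¹_Λ(A) − φ⁰_Λ(A)` is at
# most the wired probability that the window is joined to `∂Λ`, and so is the distance from `P(A)` for every FK-Gibbs `P`

Claimed R42 (8)(c) in the cell INBOX at 2026-08-28T10:00:12Z by fkp-10a gen 353 (NEW CLAIM #1 of the gen), under provision (ι) (no coordinator seated since gen 267's closing line l.8331: the lane lead absorbs the registry word, silence = consent; readers fk-ref / fkt-lead / fkp-18r / fkp-10b); lineage row FO-10a-g353 (self-suggested), package g353-weakmixing, label WM-B.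
Helper file of the `fk-continuity` build cell (bschramm lane; `--supports stmt-CriticalPhenomena-4575`); builds on
p205010 (kernel theorem, internal audit signed; external expert review pending). No definitions, no named facts, no
sorries; standard axioms. The finite-graph theorem of `BoundaryConditionInfluence.lean` (Duminil-Copin 2019,
Exercise 10) read on `ℤ^d` through the cell's region laws `regionFreeReal` / `regionWiredReal`
(`InfiniteVolumeGibbs.lean`) and the sandwich class `FKGibbs d p q`.

For a finite region `Λ ⊆ ℤ^d`, a window `W ⊆ Λ` and the event (written inline)
`J(W, Λ) = {ω | ∃ x ∈ W, ∃ y ∈ ∂Λ, x ↔ y in Λ}` ("the window is joined to the inner vertex boundary of `Λ` inside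
`Λ`"; for `W = {0}`, `Λ = Λ_n` this is the one-arm event `siteToBoundary d n`), `0 ≤ p ≤ 1`, `q ≥ 1`:

* `regionWiredReal_sub_regionFreeReal_le` — **`0 ≤ φ¹_{Λ,p,q}(A) − φ⁰_{Λ,p,q}(A) ≤ φ¹_{Λ,p,q}(J(W, Λ))`** for `A`
  increasing and determined by the edges `E_W`; `abs_regionWiredReal_sub_regionFreeReal_le_of_isLowerSet` for
  decreasing events.
* `regionWiredReal_joined_le_sum` — `φ¹_Λ(J(W, Λ)) ≤ Σ_{x ∈ W} φ¹_Λ(J({x}, Λ))`;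
  `regionWiredReal_joined_box_le_thetaWiredBox` — **`φ¹_{Λ_L}(J({x}, Λ_L)) ≤ φ¹_{Λ_j,p,q}(0 ↔ ∂Λ_j) = thetaWiredBox d p q j`**
  whenever `‖x‖_∞ + j ≤ L` (comparison of regions `x + Λ_j ⊆ Λ_L` and translation invariance): the influence is a
  ONE-ARM PROBABILITY of the wired box measure — exponentially small below `p_c(q)` (DRT sharpness, next file).
* THE SANDWICH CLASS: for every `P` with `FKGibbs d p q P`, `A` increasing determined by `E_W`, `W ⊆ Λ`, and `H` any
  event determined by finitely many edges off `E_Λ`: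
  `FKGibbs.abs_real_inter_sub_mul_le_joined` — **`|P(A ∩ H) − P(A)·P(H)| ≤ P(H) · φ¹_Λ(J(W, Λ))`** (weak mixing in
  Alexander's form (1.1)/(1.1'), with the wired one-arm probability in place of the exponential);
  `FKGibbs.abs_real_sub_regionFreeReal_le_joined`, `FKGibbs.abs_real_sub_regionWiredReal_le_joined` — the finite-volume
  laws are within `φ¹_Λ(J(W, Λ))` of `P(A)` WHATEVER THE BOUNDARY CONDITION;
  `FKGibbs.abs_real_sub_real_le_joined` — two FK-Gibbs measures at `(p,q)` differ by at most `φ¹_Λ(J(W, Λ))` on `A`;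
  decreasing twins `…_of_isLowerSet`.

## References

* H. Duminil-Copin, *Lectures on the Ising and Potts models on the hypercubic lattice*, Springer PROMS 304 (2019),
  §1.2 Exercise 10. [DuminilCopin2019]
* K. S. Alexander, *On weak mixing in lattice models*, PTRF 110 (1998) 441–471: (1.1) and its reformulation
  `sup |P(A | B) − P(A)|` (p. 444), §2 (2.7), Thm. 3.4. [Alexander1998]
* G. Grimmett, *The Random-Cluster Model*, Springer 2006: Lemma (4.13), Lemma (4.14)(b), Thm. (4.19) (4.21)/(4.24),
  §4.3 (translations). [Grimmett2006]
-/

noncomputable section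

namespace Summit.CriticalPhenomena.PercolationContinuityZ3.Theorems.FK

namespace BoundaryInfluence

open MeasureTheory Finset
open Literature.Probability.Percolation Literature.Probability.LatticeModels Literature.Barriers.CriticalPhenomena
open Literature.Probability.Percolation.OneArmOSSS Literature.Probability.Percolation.DCT16 MonotonicOSSS

variable {d : ℕ}

/-! ### Transport between the finite piece `(Λ, E_Λ)` and `ℤ^d` -/

/-- Adjacency in the open graph of a lifted configuration is adjacency in the open graph of the configuration.
[cite: Grimmett2006, §4.2 (configurations on E_Λ)] -/
theorem openGraph_liftEdges_adj_iff (Λ : Finset (Site d)) (ξ : BondConfig ↥Λ) (a b : ↥Λ) :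
    (openGraph (liftEdges Λ ξ)).Adj a.1 b.1 ↔ (openGraph ξ).Adj a b := by
  simp only [openGraph_adj, mem_liftEdges_iff, ne_eq]
  constructor
  · rintro ⟨⟨e, he, hee⟩, hne⟩
    refine ⟨?_, fun h => hne (congrArg Subtype.val h)⟩
    induction e using Sym2.ind with
    | h x y =>
      rw [Sym2.map_mk, Sym2.eq_iff] at hee
      rcases hee with ⟨hx, hy⟩ | ⟨hx, hy⟩
      · rw [Subtype.ext hx, Subtype.ext hy] at he; exact he
      · rw [Subtype.ext hx, Subtype.ext hy] at he; rw [Sym2.eq_swap]; exact he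
  · rintro ⟨he, hne⟩
    exact ⟨⟨s(a, b), he, by rw [Sym2.map_mk]⟩, fun h => hne (Subtype.ext h)⟩

/-- Open paths of a configuration of the finite piece are open paths INSIDE `Λ` of its lift to `ℤ^d`, and conversely.
[cite: Grimmett2006, §4.2 (configurations on E_Λ)] -/
theorem liftEdges_mem_openConnIn_iff (Λ : Finset (Site d)) (ξ : BondConfig ↥Λ) (x y : ↥Λ) :
    liftEdges Λ ξ ∈ openConnIn (↑Λ : Set (Site d)) x.1 y.1 ↔ (openGraph ξ).Reachable x y := by
  constructor
  · rintro ⟨hx, hy, hr⟩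
    -- pull back along the hom `⟨v, _⟩ ↦ ⟨v, _⟩`
    let g : ((openGraph (liftEdges Λ ξ)).induce (↑Λ : Set (Site d))) →g openGraph ξ :=
      { toFun := fun w => ⟨w.1, Finset.mem_coe.1 w.2⟩
        map_rel' := by
          intro a b hab
          exact (openGraph_liftEdges_adj_iff Λ ξ ⟨a.1, Finset.mem_coe.1 a.2⟩ ⟨b.1, Finset.mem_coe.1 b.2⟩).1 hab }
    exact hr.map g
  · intro hr
    let f : openGraph ξ →g (openGraph (liftEdges Λ ξ)).induce (↑Λ : Set (Site d)) :=
      { toFun := fun v => ⟨v.1, Finset.mem_coe.2 v.2⟩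
        map_rel' := by
          intro a b hab
          exact (openGraph_liftEdges_adj_iff Λ ξ a b).2 hab }
    exact ⟨Finset.mem_coe.2 x.2, Finset.mem_coe.2 y.2, hr.map f⟩

/-- The pull-back of `J(W, Λ) = {∃ x ∈ W, ∃ y ∈ ∂Λ, x ↔ y in Λ}` to the finite piece is "the window is joined to the
wired set `∂Λ`". [cite: Grimmett2006, §4.2 (4.11)–(4.12)] -/
theorem liftEdges_preimage_joined (Λ W : Finset (Site d)) (hWΛ : W ⊆ Λ) :
    liftEdges Λ ⁻¹' {ω | ∃ x ∈ W, ∃ y ∈ innerBoundary (zdGraph d) Λ, ω ∈ openConnIn (↑Λ : Set (Site d)) x y} =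
      {ξ | ∃ x ∈ Finset.univ.filter (fun x : ↥Λ => x.1 ∈ W), ∃ b ∈ wiredBoundary (zdGraph d) Λ,
        (openGraph ξ).Reachable x b} := by
  ext ξ
  simp only [Set.mem_preimage, Set.mem_setOf_eq, Finset.mem_filter, Finset.mem_univ, true_and, mem_wiredBoundary_iff]
  constructor
  · rintro ⟨x, hx, y, hy, hxy⟩
    have hyΛ : y ∈ Λ := (mem_innerBoundary_iff.1 hy).1
    exact ⟨⟨x, hWΛ hx⟩, hx, ⟨y, hyΛ⟩, hy, (liftEdges_mem_openConnIn_iff Λ ξ ⟨x, hWΛ hx⟩ ⟨y, hyΛ⟩).1 hxy⟩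
  · rintro ⟨x, hx, b, hb, hxb⟩
    exact ⟨x.1, hx, b.1, hb, (liftEdges_mem_openConnIn_iff Λ ξ x b).2 hxb⟩

/-- An event determined by `E_W` pulls back to an event determined by the edges of the finite piece inside the window.
[cite: Grimmett2006, §4.2 (configurations on E_Λ)] -/
theorem determinedBy_preimage_liftEdges_window (Λ W : Finset (Site d)) {A : Set (BondConfig (Site d))}
    (hAW : DeterminedBy A ↑(edgesIn (zdGraph d) W)) :
    DeterminedBy (liftEdges Λ ⁻¹' A)
      {e' : Sym2 ↥Λ | e' ∈ (finsetGraph (zdGraph d) Λ).edgeSet ∧ ∀ x ∈ e', x ∈ Finset.univ.filter (fun x : ↥Λ => x.1 ∈ W)} := by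
  rw [determinedBy_iff] at hAW ⊢
  intro ξ₁ ξ₂ h
  simp only [Set.mem_preimage]
  refine hAW _ _ ?_
  -- an edge of `E_W` in a lift comes from an edge of the piece inside the window
  have key : ∀ {ξ ξ' : BondConfig ↥Λ}, ξ ∩ {e' : Sym2 ↥Λ | e' ∈ (finsetGraph (zdGraph d) Λ).edgeSet ∧
        ∀ x ∈ e', x ∈ Finset.univ.filter (fun x : ↥Λ => x.1 ∈ W)} ⊆ ξ' →
      liftEdges Λ ξ ∩ ↑(edgesIn (zdGraph d) W) ⊆ liftEdges Λ ξ' := by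
    intro ξ ξ' hsub e he
    obtain ⟨⟨e', he', hmap⟩, heW⟩ := he
    rw [Finset.mem_coe, mem_edgesIn_iff] at heW
    refine ⟨e', hsub ⟨he', ?_, ?_⟩, hmap⟩
    · induction e' using Sym2.ind with
      | h a b =>
        rw [Sym2.map_mk] at hmap
        rw [SimpleGraph.mem_edgeSet]
        show (zdGraph d).Adj a.1 b.1
        have h1 := heW.1
        rw [← hmap, SimpleGraph.mem_edgeSet] at h1
        exact h1
    · intro x hx
      rw [Finset.mem_filter]
      refine ⟨Finset.mem_univ _, heW.2 x.1 ?_⟩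
      rw [← hmap]
      exact Sym2.mem_map.2 ⟨x, hx, rfl⟩
  refine Set.Subset.antisymm ?_ ?_
  · exact fun e he => ⟨key (fun e' he' => (h ▸ he' : e' ∈ ξ₂ ∩ _).1) he, he.2⟩
  · exact fun e he => ⟨key (fun e' he' => (h.symm ▸ he' : e' ∈ ξ₁ ∩ _).1) he, he.2⟩

/-! ### The influence of the boundary condition on the region laws -/

/-- **`φ¹_{Λ,p,q}(A) − φ⁰_{Λ,p,q}(A) ≤ φ¹_{Λ,p,q}(J(W, Λ))`**, `J(W, Λ) = {∃ x ∈ W, ∃ y ∈ ∂Λ, x ↔ y in Λ}`, for `A`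
increasing and determined by `E_W`, `W ⊆ Λ` (`0 ≤ p ≤ 1`, `q ≥ 1`).
[cite: DuminilCopin2019, §1.2 Exercise 10 (3); Grimmett2006, Lemma (4.14)(b)] -/
theorem regionWiredReal_sub_regionFreeReal_le {p q : ℝ} (hp : p ∈ Set.Icc (0 : ℝ) 1) (hq : 1 ≤ q)
    {Λ W : Finset (Site d)} (hWΛ : W ⊆ Λ) {A : Set (BondConfig (Site d))} (hA : IsUpperSet A)
    (hAW : DeterminedBy A ↑(edgesIn (zdGraph d) W)) :
    regionWiredReal d p q Λ A - regionFreeReal d p q Λ A ≤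
      regionWiredReal d p q Λ
        {ω | ∃ x ∈ W, ∃ y ∈ innerBoundary (zdGraph d) Λ, ω ∈ openConnIn (↑Λ : Set (Site d)) x y} := by
  rw [regionWiredReal, regionFreeReal, regionWiredReal, liftEdges_preimage_joined Λ W hWΛ]
  exact (rcMeasure_real_sub_free_mem_Icc (finsetGraph (zdGraph d) Λ) hp hq (wiredBoundary (zdGraph d) Λ)
    (Finset.univ.filter fun x : ↥Λ => x.1 ∈ W)
    (F := {e' : Sym2 ↥Λ | e' ∈ (finsetGraph (zdGraph d) Λ).edgeSet ∧
      ∀ x ∈ e', x ∈ Finset.univ.filter (fun x : ↥Λ => x.1 ∈ W)})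
    (fun e he => he) (fun ω ω' hle hω => hA (show liftEdges Λ ω ≤ liftEdges Λ ω' from Set.image_mono hle) hω)
    (determinedBy_preimage_liftEdges_window Λ W hAW)).2

/-- `0 ≤ φ¹_{Λ,p,q}(A) − φ⁰_{Λ,p,q}(A)` (the wired law dominates the free law). [cite: Grimmett2006, Lemma (4.14)(b)] -/
theorem regionWiredReal_sub_regionFreeReal_nonneg {p q : ℝ} (hp : p ∈ Set.Icc (0 : ℝ) 1) (hq : 1 ≤ q)
    {Λ W : Finset (Site d)} (hWΛ : W ⊆ Λ) {A : Set (BondConfig (Site d))} (hA : IsUpperSet A)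
    (hAW : DeterminedBy A ↑(edgesIn (zdGraph d) W)) :
    0 ≤ regionWiredReal d p q Λ A - regionFreeReal d p q Λ A :=
  sub_nonneg.2 (regionFreeReal_le_regionWiredReal_of_subset hp hq (subset_refl Λ) hA
    (hAW.mono (Finset.coe_subset.2 (edgesIn_zdGraph_mono hWΛ))))

/-- The absolute form `|φ¹_Λ(A) − φ⁰_Λ(A)| ≤ φ¹_Λ(J(W, Λ))` for increasing `A` determined by `E_W`.
[cite: DuminilCopin2019, §1.2 Exercise 10 (3); Grimmett2006, Lemma (4.14)(b)] -/
theorem abs_regionWiredReal_sub_regionFreeReal_le {p q : ℝ} (hp : p ∈ Set.Icc (0 : ℝ) 1) (hq : 1 ≤ q)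
    {Λ W : Finset (Site d)} (hWΛ : W ⊆ Λ) {A : Set (BondConfig (Site d))} (hA : IsUpperSet A)
    (hAW : DeterminedBy A ↑(edgesIn (zdGraph d) W)) :
    |regionWiredReal d p q Λ A - regionFreeReal d p q Λ A| ≤
      regionWiredReal d p q Λ
        {ω | ∃ x ∈ W, ∃ y ∈ innerBoundary (zdGraph d) Λ, ω ∈ openConnIn (↑Λ : Set (Site d)) x y} := by
  rw [abs_of_nonneg (regionWiredReal_sub_regionFreeReal_nonneg hp hq hWΛ hA hAW)]
  exact regionWiredReal_sub_regionFreeReal_le hp hq hWΛ hA hAW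

/-- **Decreasing events: `|φ¹_Λ(D) − φ⁰_Λ(D)| ≤ φ¹_Λ(J(W, Λ))`** for `D` decreasing and determined by `E_W`, `W ⊆ Λ`.
[cite: DuminilCopin2019, §1.2 Exercise 10 (3); Grimmett2006, Lemma (4.14)(b)] -/
theorem abs_regionWiredReal_sub_regionFreeReal_le_of_isLowerSet {p q : ℝ} (hp : p ∈ Set.Icc (0 : ℝ) 1) (hq : 1 ≤ q)
    {Λ W : Finset (Site d)} (hWΛ : W ⊆ Λ) {D : Set (BondConfig (Site d))} (hD : IsLowerSet D)
    (hDW : DeterminedBy D ↑(edgesIn (zdGraph d) W)) :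
    |regionWiredReal d p q Λ D - regionFreeReal d p q Λ D| ≤
      regionWiredReal d p q Λ
        {ω | ∃ x ∈ W, ∃ y ∈ innerBoundary (zdGraph d) Λ, ω ∈ openConnIn (↑Λ : Set (Site d)) x y} := by
  rw [regionWiredReal, regionFreeReal, regionWiredReal, liftEdges_preimage_joined Λ W hWΛ]
  exact abs_rcMeasure_real_sub_free_le_joined_of_isLowerSet (finsetGraph (zdGraph d) Λ) hp hq
    (wiredBoundary (zdGraph d) Λ) (Finset.univ.filter fun x : ↥Λ => x.1 ∈ W)
    (F := {e' : Sym2 ↥Λ | e' ∈ (finsetGraph (zdGraph d) Λ).edgeSet ∧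
      ∀ x ∈ e', x ∈ Finset.univ.filter (fun x : ↥Λ => x.1 ∈ W)})
    (fun e he => he) (fun ω ω' hle hω => hD (show liftEdges Λ ω' ≤ liftEdges Λ ω from Set.image_mono hle) hω)
    (determinedBy_preimage_liftEdges_window Λ W hDW)

/-! ### The joined event: union bound and the one-arm bound on boxes -/

/-- `φ¹_Λ(J(W, Λ)) ≤ Σ_{x ∈ W} φ¹_Λ(J({x}, Λ))`, `J({x}, Λ) = {∃ y ∈ ∂Λ, x ↔ y in Λ}`. [folklore] -/
theorem regionWiredReal_joined_le_sum (p q : ℝ) (Λ W : Finset (Site d)) :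
    regionWiredReal d p q Λ
        {ω | ∃ x ∈ W, ∃ y ∈ innerBoundary (zdGraph d) Λ, ω ∈ openConnIn (↑Λ : Set (Site d)) x y} ≤
      ∑ x ∈ W, regionWiredReal d p q Λ
        {ω | ∃ y ∈ innerBoundary (zdGraph d) Λ, ω ∈ openConnIn (↑Λ : Set (Site d)) x y} := by
  have hset : {ω : BondConfig (Site d) | ∃ x ∈ W, ∃ y ∈ innerBoundary (zdGraph d) Λ,
      ω ∈ openConnIn (↑Λ : Set (Site d)) x y} =
      ⋃ x ∈ W, {ω | ∃ y ∈ innerBoundary (zdGraph d) Λ, ω ∈ openConnIn (↑Λ : Set (Site d)) x y} := by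
    ext ω; simp only [Set.mem_setOf_eq, Set.mem_iUnion, exists_prop]
  simp only [regionWiredReal]
  rw [hset, Set.preimage_iUnion₂]
  exact measureReal_biUnion_finset_le W _

/-- **The influence is a one-arm probability of the wired BOX measure**: for `‖x‖_∞ + j ≤ L`,
`φ¹_{Λ_L,p,q}(J({x}, Λ_L)) ≤ φ¹_{Λ_j,p,q}(0 ↔ ∂Λ_j) = thetaWiredBox d p q j` (an open path from `x` to `∂Λ_L` crosses
`∂(x + Λ_j)`; comparison of the wired laws of `x + Λ_j ⊆ Λ_L` on this increasing event of `x + Λ_j`, eq. (4.24), and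
translation by `−x`). [cite: Grimmett2006, Thm. (4.19)(a) proof eq. (4.24) and §4.3 (translations); DuminilCopinRaoufiTassion2019, §3 (μ_n[x ↔ ∂Λ_k(x)] ≤ μ_k[0 ↔ ∂Λ_k])] -/
theorem regionWiredReal_joined_box_le_thetaWiredBox (hd : 1 ≤ d) {p q : ℝ} (hp : p ∈ Set.Icc (0 : ℝ) 1) (hq : 1 ≤ q)
    {x : Site d} {j L : ℕ} (hx : siteRad x + j ≤ L) :
    regionWiredReal d p q (box d L)
        {ω | ∃ y ∈ innerBoundary (zdGraph d) (box d L), ω ∈ openConnIn (↑(box d L) : Set (Site d)) x y} ≤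
      thetaWiredBox d p q j := by
  have hq0 : 0 < q := one_pos.trans_le hq
  calc regionWiredReal d p q (box d L)
        {ω | ∃ y ∈ innerBoundary (zdGraph d) (box d L), ω ∈ openConnIn (↑(box d L) : Set (Site d)) x y}
      = regionWiredReal d p q (box d L)
          ({ω | ∃ y ∈ innerBoundary (zdGraph d) (box d L), ω ∈ openConnIn (↑(box d L) : Set (Site d)) x y} ∩
            {ω | ω ⊆ (zdGraph d).edgeSet}) :=
        regionWiredReal_congr_lattice d hp hq0 _ fun ω hω => by
          simp only [Set.mem_inter_iff, Set.mem_setOf_eq, hω, and_true]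
    _ ≤ regionWiredReal d p q (box d L) (armEvent x j) := by
        refine regionWiredReal_mono_set d hp hq0 _ fun ω hω => ?_
        obtain ⟨⟨y, hy, hxy⟩, hωE⟩ := hω
        rw [mem_openConnIn_iff_pathIn] at hxy
        refine armEvent_of_pathIn hωE hxy (not_mem_box_or_mem_innerBoundary hd ?_)
        have hyL : boxNorm y = L := boxNorm_eq_of_mem_innerBoundary hy
        have hxs : boxNorm x = siteRad x := rfl
        have h1 := dist_boxNorm_le y x
        unfold Nat.dist at h1
        omega
    _ ≤ regionWiredReal d p q (box d j) (siteToBoundary d j) := regionWiredReal_armEvent_le_box hp hq le_rfl hx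
    _ = thetaWiredBox d p q j := by
        rw [regionWiredReal_box p q j (measurableSet_siteToBoundary d j), rcBoxLaw_true_real_siteToBoundary_self]

/-- Concentric boxes: for `W = Λ_k`, `Λ = Λ_n`, `k < n`: `φ¹_{Λ_n}(J(Λ_k, Λ_n)) ≤ |Λ_k| · thetaWiredBox d p q (n − k)`.
[cite: Grimmett2006, Thm. (4.19)(a) proof eq. (4.24); DuminilCopinRaoufiTassion2019, §3] -/
theorem regionWiredReal_joined_box_box_le (hd : 1 ≤ d) {p q : ℝ} (hp : p ∈ Set.Icc (0 : ℝ) 1) (hq : 1 ≤ q)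
    {k n : ℕ} (hkn : k ≤ n) :
    regionWiredReal d p q (box d n)
        {ω | ∃ x ∈ box d k, ∃ y ∈ innerBoundary (zdGraph d) (box d n), ω ∈ openConnIn (↑(box d n) : Set (Site d)) x y} ≤
      #(box d k) * thetaWiredBox d p q (n - k) := by
  have hq0 : 0 < q := one_pos.trans_le hq
  refine (regionWiredReal_joined_le_sum p q (box d n) (box d k)).trans ?_
  have h : ∀ x ∈ box d k, regionWiredReal d p q (box d n)
      {ω | ∃ y ∈ innerBoundary (zdGraph d) (box d n), ω ∈ openConnIn (↑(box d n) : Set (Site d)) x y} ≤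
      thetaWiredBox d p q (n - k) := fun x hx =>
    regionWiredReal_joined_box_le_thetaWiredBox hd hp hq (by have := mem_box_iff_siteRad_le.1 hx; omega)
  refine (Finset.sum_le_sum h).trans ?_
  rw [Finset.sum_const, nsmul_eq_mul]

/-! ### The sandwich class: weak mixing and finite-volume convergence in terms of the one-arm probability -/

section Gibbs

variable {p q : ℝ} {P P' : Measure (BondConfig (Site d))}

/-- **Weak mixing, increasing events: `|P(A ∩ H) − P(A)·P(H)| ≤ P(H) · φ¹_{Λ,p,q}(J(W, Λ))`** for every `P` with
`FKGibbs d p q P`, `A` increasing determined by `E_W`, `W ⊆ Λ`, `H` determined by finitely many pairs off `E_Λ`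
(`0 ≤ p ≤ 1`, `q ≥ 1`): `P(A ∩ H)` and `P(A)·P(H)` both lie in `[φ⁰_Λ(A)·P(H), φ¹_Λ(A)·P(H)]`.
[cite: Alexander1998, (1.1) and p. 444 (sup |P(A | B) − P(A)|); Grimmett2006, Lemma (4.13), Lemma (4.14)(b)] -/
theorem FKGibbs.abs_real_inter_sub_mul_le_joined (hP : FKGibbs d p q P) (hp : p ∈ Set.Icc (0 : ℝ) 1) (hq : 1 ≤ q)
    {Λ W : Finset (Site d)} (hWΛ : W ⊆ Λ) {A : Set (BondConfig (Site d))} (hA : IsUpperSet A)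
    (hAW : DeterminedBy A ↑(edgesIn (zdGraph d) W)) {H : Set (BondConfig (Site d))} (T : Finset (Sym2 (Site d)))
    (hT : Disjoint (↑T : Set (Sym2 (Site d))) ↑(edgesIn (zdGraph d) Λ)) (hH : DeterminedBy H ↑T) :
    |P.real (A ∩ H) - P.real A * P.real H| ≤
      P.real H * regionWiredReal d p q Λ
        {ω | ∃ x ∈ W, ∃ y ∈ innerBoundary (zdGraph d) Λ, ω ∈ openConnIn (↑Λ : Set (Site d)) x y} := by
  have hAΛ : DeterminedBy A ↑(edgesIn (zdGraph d) Λ) := hAW.mono (Finset.coe_subset.2 (edgesIn_zdGraph_mono hWΛ))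
  have h1 := hP.free_mul_le Λ T hA hAΛ hT hH
  have h2 := hP.le_wired_mul Λ T hA hAΛ hT hH
  have h3 := hP.regionFreeReal_le Λ hA hAΛ
  have h4 := hP.le_regionWiredReal Λ hA hAΛ
  have h5 := regionWiredReal_sub_regionFreeReal_le hp hq hWΛ hA hAW
  have hH0 : 0 ≤ P.real H := measureReal_nonneg
  rw [abs_le]
  constructor <;> nlinarith

/-- **Weak mixing, decreasing events**: the same bound for `D` decreasing determined by `E_W`.
[cite: Alexander1998, (1.1); Grimmett2006, Lemma (4.14)(b)] -/
theorem FKGibbs.abs_real_inter_sub_mul_le_joined_of_isLowerSet (hP : FKGibbs d p q P) (hp : p ∈ Set.Icc (0 : ℝ) 1)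
    (hq : 1 ≤ q) {Λ W : Finset (Site d)} (hWΛ : W ⊆ Λ) {D : Set (BondConfig (Site d))} (hD : IsLowerSet D)
    (hDW : DeterminedBy D ↑(edgesIn (zdGraph d) W)) {H : Set (BondConfig (Site d))} (T : Finset (Sym2 (Site d)))
    (hT : Disjoint (↑T : Set (Sym2 (Site d))) ↑(edgesIn (zdGraph d) Λ)) (hH : DeterminedBy H ↑T) :
    |P.real (D ∩ H) - P.real D * P.real H| ≤
      P.real H * regionWiredReal d p q Λ
        {ω | ∃ x ∈ W, ∃ y ∈ innerBoundary (zdGraph d) Λ, ω ∈ openConnIn (↑Λ : Set (Site d)) x y} := by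
  haveI := hP.isProbabilityMeasure
  have hDc : IsUpperSet Dᶜ := hD.compl
  have hDcW : DeterminedBy Dᶜ ↑(edgesIn (zdGraph d) W) :=
    (determinedBy_iff _ _).2 fun ω₁ ω₂ h => not_congr ((determinedBy_iff D _).1 hDW ω₁ ω₂ h)
  have hDm : MeasurableSet D := hDW.measurableSet_of_finset
  have h := FKGibbs.abs_real_inter_sub_mul_le_joined hP hp hq hWΛ hDc hDcW T hT hH
  have h1 : P.real (Dᶜ ∩ H) = P.real H - P.real (D ∩ H) := by
    have h0 : P.real (H ∩ D) + P.real (H \ D) = P.real H := measureReal_inter_add_sdiff (s := H) hDm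
    rw [Set.sdiff_eq_compl_inter, Set.inter_comm H D] at h0
    linarith
  rw [h1, probReal_compl_eq_one_sub hDm] at h
  rw [abs_le] at h ⊢
  constructor <;> nlinarith [h.1, h.2]

/-- **Every FK-Gibbs measure is within the one-arm influence of the FREE region law:
`|P(A) − φ⁰_{Λ,p,q}(A)| ≤ φ¹_{Λ,p,q}(J(W, Λ))`** (`A` increasing determined by `E_W`, `W ⊆ Λ`).
[cite: Grimmett2006, Thm. (4.19)(c) (4.21); DuminilCopin2019, §1.2 Exercise 10 (3)] -/
theorem FKGibbs.abs_real_sub_regionFreeReal_le_joined (hP : FKGibbs d p q P) (hp : p ∈ Set.Icc (0 : ℝ) 1) (hq : 1 ≤ q)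
    {Λ W : Finset (Site d)} (hWΛ : W ⊆ Λ) {A : Set (BondConfig (Site d))} (hA : IsUpperSet A)
    (hAW : DeterminedBy A ↑(edgesIn (zdGraph d) W)) :
    |P.real A - regionFreeReal d p q Λ A| ≤
      regionWiredReal d p q Λ
        {ω | ∃ x ∈ W, ∃ y ∈ innerBoundary (zdGraph d) Λ, ω ∈ openConnIn (↑Λ : Set (Site d)) x y} := by
  have hAΛ : DeterminedBy A ↑(edgesIn (zdGraph d) Λ) := hAW.mono (Finset.coe_subset.2 (edgesIn_zdGraph_mono hWΛ))
  have h3 := hP.regionFreeReal_le Λ hA hAΛ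
  have h4 := hP.le_regionWiredReal Λ hA hAΛ
  have h5 := regionWiredReal_sub_regionFreeReal_le hp hq hWΛ hA hAW
  rw [abs_le]
  constructor <;> linarith

/-- **… and of the WIRED region law: `|P(A) − φ¹_{Λ,p,q}(A)| ≤ φ¹_{Λ,p,q}(J(W, Λ))`**.
[cite: Grimmett2006, Thm. (4.19)(c) (4.21); DuminilCopin2019, §1.2 Exercise 10 (3)] -/
theorem FKGibbs.abs_real_sub_regionWiredReal_le_joined (hP : FKGibbs d p q P) (hp : p ∈ Set.Icc (0 : ℝ) 1) (hq : 1 ≤ q)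
    {Λ W : Finset (Site d)} (hWΛ : W ⊆ Λ) {A : Set (BondConfig (Site d))} (hA : IsUpperSet A)
    (hAW : DeterminedBy A ↑(edgesIn (zdGraph d) W)) :
    |P.real A - regionWiredReal d p q Λ A| ≤
      regionWiredReal d p q Λ
        {ω | ∃ x ∈ W, ∃ y ∈ innerBoundary (zdGraph d) Λ, ω ∈ openConnIn (↑Λ : Set (Site d)) x y} := by
  have hAΛ : DeterminedBy A ↑(edgesIn (zdGraph d) Λ) := hAW.mono (Finset.coe_subset.2 (edgesIn_zdGraph_mono hWΛ))
  have h3 := hP.regionFreeReal_le Λ hA hAΛ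
  have h4 := hP.le_regionWiredReal Λ hA hAΛ
  have h5 := regionWiredReal_sub_regionFreeReal_le hp hq hWΛ hA hAW
  rw [abs_le]
  constructor <;> linarith

/-- **Two FK-Gibbs measures at the same `(p, q)` differ by at most the one-arm influence**:
`|P(A) − P'(A)| ≤ φ¹_{Λ,p,q}(J(W, Λ))` for every `Λ ⊇ W` (`A` increasing determined by `E_W`).
[cite: Grimmett2006, Thm. (4.19)(c) (4.21) and (4.36); DuminilCopin2019, §1.2 Exercise 10 (3)] -/
theorem FKGibbs.abs_real_sub_real_le_joined (hP : FKGibbs d p q P) (hP' : FKGibbs d p q P') (hp : p ∈ Set.Icc (0 : ℝ) 1)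
    (hq : 1 ≤ q) {Λ W : Finset (Site d)} (hWΛ : W ⊆ Λ) {A : Set (BondConfig (Site d))} (hA : IsUpperSet A)
    (hAW : DeterminedBy A ↑(edgesIn (zdGraph d) W)) :
    |P.real A - P'.real A| ≤
      regionWiredReal d p q Λ
        {ω | ∃ x ∈ W, ∃ y ∈ innerBoundary (zdGraph d) Λ, ω ∈ openConnIn (↑Λ : Set (Site d)) x y} := by
  have hAΛ : DeterminedBy A ↑(edgesIn (zdGraph d) Λ) := hAW.mono (Finset.coe_subset.2 (edgesIn_zdGraph_mono hWΛ))
  have h3 := hP.regionFreeReal_le Λ hA hAΛ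
  have h4 := hP.le_regionWiredReal Λ hA hAΛ
  have h3' := hP'.regionFreeReal_le Λ hA hAΛ
  have h4' := hP'.le_regionWiredReal Λ hA hAΛ
  have h5 := regionWiredReal_sub_regionFreeReal_le hp hq hWΛ hA hAW
  rw [abs_le]
  constructor <;> linarith

end Gibbs

end BoundaryInfluence

end Summit.CriticalPhenomena.PercolationContinuityZ3.Theorems.FK

end
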